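import Literature.Analysis.ODE.SlowColumnSlavingIntWindow
import Literature.Analysis.FluidPDE.QuasiStaticSlotWeight
import HarnessLib

/-!
# The slot-column law for a trapezoid slot, in closed form
# (quasi-static weight `1 − 4ρ/3` with the explicit `O((ρτ)⁻¹Λ⁻¹)` lag; end-of-slot fast residual)

Topic `Literature/Analysis/ODE` (namespace `Literature.Analysis.ODE.IntWindowLadder`). Everything here is PROVED (no
definition, no named fact). This file CLOSES the two free inputs of
`Literature.Analysis.ODE.IntWindowLadder.column_law_intWindow` / `column_remainder_intWindow` — the Duhamel responses
`j_{±1}` and the primitive `Φ` — for the coupling that shear-flow cell problems actually produce on one slot: a real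
amplitude times the unit trapezoid envelope, `g(t) = g₁ · trapezoid 0 τ ρ (t − t₀)` on the window `[t₀, t₀ + τ]`
(ramps of length `ρτ`, `0 < ρ ≤ 1/2`; [cite: ArmstrongVicol2025, §4 p. 17 (time cutoff)]). The responses are the
Duhamel integrals of `Literature.Analysis.FluidPDE.QuasiStaticSlotWeight` (`LatticeShear.hasDerivAt_duhamel`,
[cite: MajdaKramer1999, §2.2.1.3 (55)]), `Φ` is their weighted primitive, and the realised weight
`λ∫₀^τ a J_λ[a] = τ(1 − 4ρ/3) + O(2/(ρτλ²))` (`abs_mul_integral_trapezoid_duhamel_sub_le`) turns the two-sided law of the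
Riccati decoupling [cite: Eastham1989, §1.5 Thm 1.5.1, §1.6 Thm 1.6.1]
[cite: KokotovicBensoussanBlankenship1987, Kokotović §2 Thm 2.3 (2.40)] into a CLOSED-FORM law for the slow entry of
the column of the slot propagator:

* `column_law_trapezoid` — with `δ_± = d(±1) − d 0 ≥ Δ > 0`, `γ² = s 0² + s(−1)²`, cone radius `R`
  (`|g₁| γ (1 + R²) < Δ R`) and `Q = |g₁| R (2 + γR)/Δ`:
  `|log ‖v_0(t₀+τ)‖² − log ‖v_0(t₀)‖² + 2Λ d_0 τ + 2Λ g₁² τ (1 − 4ρ/3)(s 0²/δ₊ + s(−1)²/δ₋)|`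
  `≤ 2Λ |g₁| γ Q τ + (4 g₁²/(Λρτ))·(s 0²/δ₊³ + s(−1)²/δ₋³)`;
* `column_residual_trapezoid` — at the END of the slot the fast part of the column is second-order small:
  `√(Σ_{J≠0} ‖v_J(t₀+τ)‖²) ≤ (Q + (|g₁|/(Λρτ))·(|s 0|/δ₊² + |s(−1)|/δ₋²))·‖v_0(t₀+τ)‖`
  (`column_remainder_intWindow` + `duhamel_trapezoid_end_le`).

* `column_law_trapezoidPair`, `column_residual_trapezoidPair` — the same two statements for a same-direction PAIR
  of consecutive slots on one ladder, `g(t) = c₁·trapezoid 0 τ₁ ρ (t − t₀) + c₂·trapezoid τ₁ τ₂ ρ (t − t₀)`: the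
  weights add, `(c₁²τ₁ + c₂²τ₂)(1 − 4ρ/3)`, plus each hump's lag and one third-order cross term
  (`abs_mul_integral_pair_duhamel_sub_le`).

These are the per-slot numbers `x_j = g₁² T ϑ(ρ,T)`-type exponent and `R_end` of a near-sector slot map, uniformly in
the window `W` (Galerkin truncation).
-/

noncomputable section

namespace Literature.Analysis.ODE

namespace IntWindowLadder

open Set Finset Complex Filter MeasureTheory intervalIntegral
open scoped BigOperators ComplexConjugate Topology
open Literature.Analysis.FluidPDE Literature.Analysis.FluidPDE.LatticeShear

/-! ## §0 Bookkeeping: the unit trapezoid, its Duhamel response, Minkowski on a finset -/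

/-- The unit trapezoid is continuous. [folklore] -/
private theorem continuous_unitTrapezoid (τ ρ : ℝ) : Continuous fun x => LatticeWord.trapezoid 0 τ ρ x := by
  unfold LatticeWord.trapezoid; fun_prop

/-- `0 ≤ trapezoid ≤ 1`. [folklore] -/
private theorem unitTrapezoid_mem_Icc (τ ρ x : ℝ) : LatticeWord.trapezoid 0 τ ρ x ∈ Icc (0:ℝ) 1 := by
  unfold LatticeWord.trapezoid
  exact ⟨le_max_left _ _, max_le zero_le_one (min_le_left _ _)⟩

/-- Minkowski in `ℓ²` of a finset: `√Σ(a+b)² ≤ √Σa² + √Σb²`. [folklore] -/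
private theorem sqrt_sum_add_sq_le {ι : Type*} (S : Finset ι) (a b : ι → ℝ) :
    Real.sqrt (∑ i ∈ S, (a i + b i) ^ 2) ≤ Real.sqrt (∑ i ∈ S, a i ^ 2) + Real.sqrt (∑ i ∈ S, b i ^ 2) := by
  have hA := Real.sqrt_nonneg (∑ i ∈ S, a i ^ 2)
  have hB := Real.sqrt_nonneg (∑ i ∈ S, b i ^ 2)
  have hcs := Real.sum_mul_le_sqrt_mul_sqrt S a b
  have hle : ∑ i ∈ S, (a i + b i) ^ 2 ≤
      (Real.sqrt (∑ i ∈ S, a i ^ 2) + Real.sqrt (∑ i ∈ S, b i ^ 2)) ^ 2 := by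
    have e : ∑ i ∈ S, (a i + b i) ^ 2 = ∑ i ∈ S, a i ^ 2 + 2 * ∑ i ∈ S, a i * b i + ∑ i ∈ S, b i ^ 2 := by
      rw [Finset.mul_sum, ← Finset.sum_add_distrib, ← Finset.sum_add_distrib]
      exact Finset.sum_congr rfl fun i _ => by ring
    rw [e, add_sq, Real.sq_sqrt (Finset.sum_nonneg fun i _ => sq_nonneg (a i)),
      Real.sq_sqrt (Finset.sum_nonneg fun i _ => sq_nonneg (b i))]
    nlinarith [hcs]
  calc Real.sqrt (∑ i ∈ S, (a i + b i) ^ 2)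
      ≤ Real.sqrt ((Real.sqrt (∑ i ∈ S, a i ^ 2) + Real.sqrt (∑ i ∈ S, b i ^ 2)) ^ 2) := Real.sqrt_le_sqrt hle
    _ = _ := Real.sqrt_sq (add_nonneg hA hB)

/-! ## §1 The closed-form column law on a trapezoid slot -/

/-- **The slot-column law for a trapezoid slot, closed form.** Three-term ladder on a finite window `W ∋ 0, ±1` with
real links `|s J| ≤ 1`, gap `d J ≥ d 0 + Δ` off `0` (`Δ > 0`), rate `Λ > 0`, and the slot coupling
`g(t) = g₁ · trapezoid 0 τ ρ (t − t₀)` on `[t₀, t₀ + τ]` (`τ > 0`, ramps `0 < ρ ≤ 1/2`); `γ² = s 0² + s(−1)²`, cone radius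
`R > 0` with `|g₁| γ (1 + R²) < Δ R`. For the COLUMN datum (`v_J(t₀) = 0` for `J ≠ 0`, `v_0(t₀) ≠ 0`), writing
`δ₊ = d 1 − d 0`, `δ₋ = d(−1) − d 0` and `Q = |g₁| R (2 + γR)/Δ`:
`|log ‖v_0(t₀+τ)‖² − log ‖v_0(t₀)‖² + 2Λ d_0 τ + 2Λ g₁² τ(1 − 4ρ/3)(s 0²/δ₊ + s(−1)²/δ₋)| ≤ 2Λ|g₁|γQτ + (4g₁²/(Λρτ))(s 0²/δ₊³ + s(−1)²/δ₋³)`.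
The main term is the quasi-static slot weight (`∫trapezoid² = τ(1 − 4ρ/3)`) at the Taylor rate `g₁² s_±²/δ_±` per
neighbour; the last term is the `O(T⁻²)` lag of the Duhamel response (`T = Λδτ`).
[cite: Eastham1989, §1.5 Thm 1.5.1 (1.5.5), §1.6 Thm 1.6.1] [cite: MajdaKramer1999, §2.2.1.3 (55)]
[cite: KokotovicBensoussanBlankenship1987, Kokotović §2 Thm 2.3 (2.40)] -/
theorem column_law_trapezoid (W : Finset ℤ) (h0 : (0 : ℤ) ∈ W) (h1 : (1 : ℤ) ∈ W) (hm1 : (-1 : ℤ) ∈ W)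
    (d s : ℤ → ℝ) (Λ Δ γ R t₀ τ ρ g₁ : ℝ) (g : ℝ → ℝ) (v : ℝ → ℤ → ℂ)
    (hs : ∀ J ∈ W, |s J| ≤ 1) (hγ : γ ^ 2 = s 0 ^ 2 + s (-1) ^ 2) (hγ0 : 0 ≤ γ)
    (hΔ : ∀ J ∈ W, J ≠ 0 → d 0 + Δ ≤ d J) (hΔ0 : 0 < Δ) (hΛ : 0 < Λ)
    (hτ : 0 < τ) (hρ : 0 < ρ) (hρ2 : ρ ≤ 1 / 2) (hR : 0 < R) (htrap : |g₁| * γ * (1 + R ^ 2) < Δ * R)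
    (hgdef : ∀ t ∈ Icc t₀ (t₀ + τ), g t = g₁ * LatticeWord.trapezoid 0 τ ρ (t - t₀))
    (hsupp : ∀ t ∈ Icc t₀ (t₀ + τ), ∀ J, J ∉ W → v t J = 0)
    (hderiv : ∀ t ∈ Icc t₀ (t₀ + τ), ∀ J ∈ W, HasDerivWithinAt (fun t' => v t' J)
        (-(Λ : ℂ) * ((d J : ℂ) * v t J) - (g t : ℂ) * (Λ : ℂ) * ((s (J - 1) : ℂ) * v t (J - 1) - (s J : ℂ) * v t (J + 1)))
        (Icc t₀ (t₀ + τ)) t)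
    (hcol : ∀ J, J ≠ 0 → v t₀ J = 0) (hv0 : v t₀ 0 ≠ 0) :
    |Real.log (‖v (t₀ + τ) 0‖ ^ 2) - Real.log (‖v t₀ 0‖ ^ 2) + 2 * Λ * d 0 * τ +
        2 * Λ * g₁ ^ 2 * (τ * (1 - 4 * ρ / 3)) * (s 0 ^ 2 / (d 1 - d 0) + s (-1) ^ 2 / (d (-1) - d 0))|
      ≤ 2 * Λ * |g₁| * γ * (|g₁| * R * (2 + γ * R) / Δ) * τ +
        4 * g₁ ^ 2 / (Λ * ρ * τ) * (s 0 ^ 2 / (d 1 - d 0) ^ 3 + s (-1) ^ 2 / (d (-1) - d 0) ^ 3) := by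
  -- gaps to the two neighbours
  have hδp0 : 0 < d 1 - d 0 := by have := hΔ 1 h1 one_ne_zero; linarith
  have hδm0 : 0 < d (-1) - d 0 := by have := hΔ (-1) hm1 (by norm_num); linarith
  have hlp0 : 0 < Λ * (d 1 - d 0) := mul_pos hΛ hδp0
  have hlm0 : 0 < Λ * (d (-1) - d 0) := mul_pos hΛ hδm0
  have ht₁mem : t₀ + τ ∈ Icc t₀ (t₀ + τ) := right_mem_Icc.2 (by linarith)
  -- the unit trapezoid and its Duhamel responses (slot-local time)
  set a : ℝ → ℝ := fun x => LatticeWord.trapezoid 0 τ ρ x with hadef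
  have ha : Continuous a := continuous_unitTrapezoid τ ρ
  set J : ℝ → ℝ → ℝ := fun lam x => Real.exp (-lam * x) * ∫ y in (0:ℝ)..x, Real.exp (lam * y) * a y
    with hJdef
  have hJ : ∀ lam x, HasDerivAt (J lam) (a x - lam * J lam x) x := fun lam x => by
    simp only [hJdef]; exact hasDerivAt_duhamel ha lam x
  have hJc : ∀ lam, Continuous (J lam) := fun lam =>
    continuous_iff_continuousAt.2 fun x => (hJ lam x).continuousAt
  have hJ0 : ∀ lam, J lam 0 = 0 := fun lam => by
    simp only [hJdef, intervalIntegral.integral_same, mul_zero]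
  set K : ℝ → ℝ → ℝ := fun lam x => ∫ y in (0:ℝ)..x, a y * J lam y with hKdef
  have hK : ∀ lam x, HasDerivAt (K lam) (a x * J lam x) x := fun lam x => by
    simp only [hKdef]
    exact ((ha.mul (hJc lam)).integral_hasStrictDerivAt 0 x).hasDerivAt
  have hK0 : ∀ lam, K lam 0 = 0 := fun lam => by simp only [hKdef, intervalIntegral.integral_same]
  have hshift : ∀ t, HasDerivAt (fun t => t - t₀) 1 t := fun t => (hasDerivAt_id t).sub_const t₀
  have hga : ∀ t ∈ Icc t₀ (t₀ + τ), g t = g₁ * a (t - t₀) := fun t ht => by rw [hgdef t ht]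
  -- the responses and the primitive in window time
  have hjd : ∀ lam, ∀ t ∈ Icc t₀ (t₀ + τ), HasDerivWithinAt (fun t => g₁ * J lam (t - t₀))
      (g t - lam * (g₁ * J lam (t - t₀))) (Icc t₀ (t₀ + τ)) t := by
    intro lam t ht
    have h := ((hJ lam (t - t₀)).comp t (hshift t)).const_mul g₁
    refine (h.congr_deriv ?_).hasDerivWithinAt
    rw [hga t ht]
    ring
  have hΦd : ∀ t ∈ Icc t₀ (t₀ + τ), HasDerivWithinAt
      (fun t => Λ * g₁ ^ 2 * (s 0 ^ 2 * K (Λ * (d 1 - d 0)) (t - t₀) + s (-1) ^ 2 * K (Λ * (d (-1) - d 0)) (t - t₀)))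
      (Λ * g t * (s 0 ^ 2 * (g₁ * J (Λ * (d 1 - d 0)) (t - t₀)) +
        s (-1) ^ 2 * (g₁ * J (Λ * (d (-1) - d 0)) (t - t₀)))) (Icc t₀ (t₀ + τ)) t := by
    intro t ht
    have hp := ((hK (Λ * (d 1 - d 0)) (t - t₀)).comp t (hshift t)).const_mul (s 0 ^ 2)
    have hm := ((hK (Λ * (d (-1) - d 0)) (t - t₀)).comp t (hshift t)).const_mul (s (-1) ^ 2)
    have h := (hp.add hm).const_mul (Λ * g₁ ^ 2)
    refine (h.congr_deriv ?_).hasDerivWithinAt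
    rw [hga t ht]
    ring
  -- bounds on the coupling
  have hg : ∀ t ∈ Ioo t₀ (t₀ + τ), |g t| ≤ |g₁| := by
    intro t ht
    rw [hgdef t (Ioo_subset_Icc_self ht), abs_mul]
    have hm := unitTrapezoid_mem_Icc τ ρ (t - t₀)
    have : |LatticeWord.trapezoid 0 τ ρ (t - t₀)| ≤ 1 := abs_le.2 ⟨by linarith [hm.1], hm.2⟩
    exact mul_le_of_le_one_right (abs_nonneg _) this
  -- the two-sided column law with these responses, at the end of the slot
  have key := column_law_intWindow W h0 h1 hm1 d s Λ |g₁| Δ γ R t₀ (t₀ + τ) g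
    (fun t => Λ * g₁ ^ 2 * (s 0 ^ 2 * K (Λ * (d 1 - d 0)) (t - t₀) + s (-1) ^ 2 * K (Λ * (d (-1) - d 0)) (t - t₀)))
    (fun t => g₁ * J (Λ * (d 1 - d 0)) (t - t₀)) (fun t => g₁ * J (Λ * (d (-1) - d 0)) (t - t₀)) v
    hs hγ hγ0 hΔ hΔ0 hΛ hg (abs_nonneg g₁) hR htrap hsupp hderiv hcol hv0
    (hjd (Λ * (d 1 - d 0))) (by simp only [sub_self, hJ0, mul_zero])
    (hjd (Λ * (d (-1) - d 0))) (by simp only [sub_self, hJ0, mul_zero]) hΦd (t₀ + τ) ht₁mem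
  simp only [sub_self, hK0, mul_zero, add_zero, sub_zero, add_sub_cancel_left] at key
  -- the realised weights: `λ K_λ(τ) = τ(1 − 4ρ/3) + E_λ`, `|E_λ| ≤ 2/(ρτλ²)`
  have hE : ∀ lam, 0 < lam → |lam * K lam τ - τ * (1 - 4 * ρ / 3)| ≤ 2 / (ρ * τ * lam ^ 2) := by
    intro lam hlam
    have h := abs_mul_integral_trapezoid_duhamel_sub_le hτ hρ hρ2 hlam
    simp only [hKdef, hJdef, hadef]
    exact h
  have hdec : ∀ lam, 0 < lam →
      ∃ E, K lam τ = (τ * (1 - 4 * ρ / 3) + E) / lam ∧ |E| ≤ 2 / (ρ * τ * lam ^ 2) :=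
    fun lam hlam => ⟨lam * K lam τ - τ * (1 - 4 * ρ / 3), by field_simp; ring, hE lam hlam⟩
  obtain ⟨Ep, hKp, hEp⟩ := hdec (Λ * (d 1 - d 0)) hlp0
  obtain ⟨Em, hKm, hEm⟩ := hdec (Λ * (d (-1) - d 0)) hlm0
  rw [hKp, hKm] at key
  -- split off the lag terms
  have hsplit : Real.log (‖v (t₀ + τ) 0‖ ^ 2) - Real.log (‖v t₀ 0‖ ^ 2) + 2 * Λ * d 0 * τ +
      2 * Λ * g₁ ^ 2 * (τ * (1 - 4 * ρ / 3)) * (s 0 ^ 2 / (d 1 - d 0) + s (-1) ^ 2 / (d (-1) - d 0)) =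
      (Real.log (‖v (t₀ + τ) 0‖ ^ 2) - Real.log (‖v t₀ 0‖ ^ 2) + 2 * Λ * d 0 * τ +
        2 * Λ * (Λ * g₁ ^ 2 * (s 0 ^ 2 * ((τ * (1 - 4 * ρ / 3) + Ep) / (Λ * (d 1 - d 0))) +
          s (-1) ^ 2 * ((τ * (1 - 4 * ρ / 3) + Em) / (Λ * (d (-1) - d 0)))))) -
      2 * Λ * g₁ ^ 2 * (s 0 ^ 2 * Ep / (d 1 - d 0) + s (-1) ^ 2 * Em / (d (-1) - d 0)) := by
    field_simp
    ring
  have h2nd : |2 * Λ * g₁ ^ 2 * (s 0 ^ 2 * Ep / (d 1 - d 0) + s (-1) ^ 2 * Em / (d (-1) - d 0))|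
      ≤ 4 * g₁ ^ 2 / (Λ * ρ * τ) * (s 0 ^ 2 / (d 1 - d 0) ^ 3 + s (-1) ^ 2 / (d (-1) - d 0) ^ 3) := by
    rw [abs_mul, abs_of_nonneg (by positivity : 0 ≤ 2 * Λ * g₁ ^ 2)]
    have hp : |s 0 ^ 2 * Ep / (d 1 - d 0)| ≤
        s 0 ^ 2 * (2 / (ρ * τ * (Λ * (d 1 - d 0)) ^ 2)) / (d 1 - d 0) := by
      rw [abs_div, abs_mul, abs_of_nonneg (sq_nonneg _), abs_of_pos hδp0]
      exact div_le_div_of_nonneg_right (mul_le_mul_of_nonneg_left hEp (sq_nonneg _)) hδp0.le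
    have hm : |s (-1) ^ 2 * Em / (d (-1) - d 0)| ≤
        s (-1) ^ 2 * (2 / (ρ * τ * (Λ * (d (-1) - d 0)) ^ 2)) / (d (-1) - d 0) := by
      rw [abs_div, abs_mul, abs_of_nonneg (sq_nonneg _), abs_of_pos hδm0]
      exact div_le_div_of_nonneg_right (mul_le_mul_of_nonneg_left hEm (sq_nonneg _)) hδm0.le
    calc 2 * Λ * g₁ ^ 2 * |s 0 ^ 2 * Ep / (d 1 - d 0) + s (-1) ^ 2 * Em / (d (-1) - d 0)|
        ≤ 2 * Λ * g₁ ^ 2 * (s 0 ^ 2 * (2 / (ρ * τ * (Λ * (d 1 - d 0)) ^ 2)) / (d 1 - d 0) +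
            s (-1) ^ 2 * (2 / (ρ * τ * (Λ * (d (-1) - d 0)) ^ 2)) / (d (-1) - d 0)) :=
          mul_le_mul_of_nonneg_left ((abs_add_le _ _).trans (add_le_add hp hm)) (by positivity)
      _ = 4 * g₁ ^ 2 / (Λ * ρ * τ) * (s 0 ^ 2 / (d 1 - d 0) ^ 3 + s (-1) ^ 2 / (d (-1) - d 0) ^ 3) := by
          field_simp
          ring
  rw [hsplit]
  exact (abs_sub _ _).trans (add_le_add key h2nd)

/-! ## §2 The end-of-slot fast residual of the column -/

/-- **End-of-slot fast residual of the column, trapezoid slot.** Under the hypotheses of `column_law_trapezoid`, at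
the end `t₀ + τ` of the slot the fast components of the column are
`√(Σ_{J ∈ W∖0} ‖v_J(t₀+τ)‖²) ≤ (Q + (|g₁|/(Λρτ))(|s 0|/δ₊² + |s(−1)|/δ₋²))·‖v_0(t₀+τ)‖`, `Q = |g₁| R (2 + γR)/Δ`:
the slaved profile `∓Λ s j_{±1}` has relaxed with the ramp (`J[trapezoid](τ) ≤ 1/(ρτλ²)`,
`duhamel_trapezoid_end_le`) and only the second-order remainder `Q` of the Riccati expansion is left.
[cite: Eastham1989, §1.5 Thm 1.5.1, (1.5.8)–(1.5.10)] [cite: MajdaKramer1999, §2.2.1.3 (55)] -/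
theorem column_residual_trapezoid (W : Finset ℤ) (h0 : (0 : ℤ) ∈ W) (h1 : (1 : ℤ) ∈ W) (hm1 : (-1 : ℤ) ∈ W)
    (d s : ℤ → ℝ) (Λ Δ γ R t₀ τ ρ g₁ : ℝ) (g : ℝ → ℝ) (v : ℝ → ℤ → ℂ)
    (hs : ∀ J ∈ W, |s J| ≤ 1) (hγ : γ ^ 2 = s 0 ^ 2 + s (-1) ^ 2) (hγ0 : 0 ≤ γ)
    (hΔ : ∀ J ∈ W, J ≠ 0 → d 0 + Δ ≤ d J) (hΔ0 : 0 < Δ) (hΛ : 0 < Λ)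
    (hτ : 0 < τ) (hρ : 0 < ρ) (hR : 0 < R) (htrap : |g₁| * γ * (1 + R ^ 2) < Δ * R)
    (hgdef : ∀ t ∈ Icc t₀ (t₀ + τ), g t = g₁ * LatticeWord.trapezoid 0 τ ρ (t - t₀))
    (hsupp : ∀ t ∈ Icc t₀ (t₀ + τ), ∀ J, J ∉ W → v t J = 0)
    (hderiv : ∀ t ∈ Icc t₀ (t₀ + τ), ∀ J ∈ W, HasDerivWithinAt (fun t' => v t' J)
        (-(Λ : ℂ) * ((d J : ℂ) * v t J) - (g t : ℂ) * (Λ : ℂ) * ((s (J - 1) : ℂ) * v t (J - 1) - (s J : ℂ) * v t (J + 1)))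
        (Icc t₀ (t₀ + τ)) t)
    (hcol : ∀ J, J ≠ 0 → v t₀ J = 0) (hv0 : v t₀ 0 ≠ 0) :
    Real.sqrt (∑ J ∈ W.erase 0, ‖v (t₀ + τ) J‖ ^ 2) ≤
      (|g₁| * R * (2 + γ * R) / Δ +
        |g₁| / (Λ * ρ * τ) * (|s 0| / (d 1 - d 0) ^ 2 + |s (-1)| / (d (-1) - d 0) ^ 2)) * ‖v (t₀ + τ) 0‖ := by
  classical
  have hδp0 : 0 < d 1 - d 0 := by have := hΔ 1 h1 one_ne_zero; linarith
  have hδm0 : 0 < d (-1) - d 0 := by have := hΔ (-1) hm1 (by norm_num); linarith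
  have hlp0 : 0 < Λ * (d 1 - d 0) := mul_pos hΛ hδp0
  have hlm0 : 0 < Λ * (d (-1) - d 0) := mul_pos hΛ hδm0
  have ht₁mem : t₀ + τ ∈ Icc t₀ (t₀ + τ) := right_mem_Icc.2 (by linarith)
  set a : ℝ → ℝ := fun x => LatticeWord.trapezoid 0 τ ρ x with hadef
  have ha : Continuous a := continuous_unitTrapezoid τ ρ
  set J : ℝ → ℝ → ℝ := fun lam x => Real.exp (-lam * x) * ∫ y in (0:ℝ)..x, Real.exp (lam * y) * a y
    with hJdef
  have hJ : ∀ lam x, HasDerivAt (J lam) (a x - lam * J lam x) x := fun lam x => by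
    simp only [hJdef]; exact hasDerivAt_duhamel ha lam x
  have hJ0 : ∀ lam, J lam 0 = 0 := fun lam => by
    simp only [hJdef, intervalIntegral.integral_same, mul_zero]
  have hshift : ∀ t, HasDerivAt (fun t => t - t₀) 1 t := fun t => (hasDerivAt_id t).sub_const t₀
  have hga : ∀ t ∈ Icc t₀ (t₀ + τ), g t = g₁ * a (t - t₀) := fun t ht => by rw [hgdef t ht]
  have hjd : ∀ lam, ∀ t ∈ Icc t₀ (t₀ + τ), HasDerivWithinAt (fun t => g₁ * J lam (t - t₀))
      (g t - lam * (g₁ * J lam (t - t₀))) (Icc t₀ (t₀ + τ)) t := by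
    intro lam t ht
    have h := ((hJ lam (t - t₀)).comp t (hshift t)).const_mul g₁
    refine (h.congr_deriv ?_).hasDerivWithinAt
    rw [hga t ht]
    ring
  have hg : ∀ t ∈ Ioo t₀ (t₀ + τ), |g t| ≤ |g₁| := by
    intro t ht
    rw [hgdef t (Ioo_subset_Icc_self ht), abs_mul]
    have hm := unitTrapezoid_mem_Icc τ ρ (t - t₀)
    have : |LatticeWord.trapezoid 0 τ ρ (t - t₀)| ≤ 1 := abs_le.2 ⟨by linarith [hm.1], hm.2⟩
    exact mul_le_of_le_one_right (abs_nonneg _) this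
  -- end values of the responses: `0 ≤ J(τ) ≤ 1/(ρτλ²)`
  have hJend : ∀ lam, 0 < lam → |J lam (t₀ + τ - t₀)| ≤ 1 / (ρ * τ * lam ^ 2) := by
    intro lam hlam
    rw [add_sub_cancel_left]
    have h0 : 0 ≤ J lam τ := by
      simp only [hJdef, hadef]
      exact duhamel_nonneg (fun x => (unitTrapezoid_mem_Icc τ ρ x).1) hτ.le
    have h1 : J lam τ ≤ 1 / (ρ * τ * lam ^ 2) := by
      simp only [hJdef, hadef]
      exact duhamel_trapezoid_end_le hτ hρ hlam
    rw [abs_of_nonneg h0]; exact h1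
  -- the slaved profile with remainder `Q`
  have hrem := column_remainder_intWindow W h0 h1 hm1 d s Λ |g₁| Δ γ R t₀ (t₀ + τ) g
    (fun t => g₁ * J (Λ * (d 1 - d 0)) (t - t₀)) (fun t => g₁ * J (Λ * (d (-1) - d 0)) (t - t₀)) v
    hs hγ hγ0 hΔ hΔ0 hΛ hg (abs_nonneg g₁) hR htrap hsupp hderiv hcol hv0
    (hjd (Λ * (d 1 - d 0))) (by simp only [sub_self, hJ0, mul_zero])
    (hjd (Λ * (d (-1) - d 0))) (by simp only [sub_self, hJ0, mul_zero]) (t₀ + τ) ht₁mem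
  -- the slow mode does not vanish at the end of the slot
  have hinit : ∑ J ∈ W.erase 0, ‖v t₀ J‖ ^ 2 < R ^ 2 * ‖v t₀ 0‖ ^ 2 := by
    rw [Finset.sum_eq_zero (fun J hJ => by rw [hcol J (Finset.ne_of_mem_erase hJ), norm_zero, zero_pow two_ne_zero])]
    exact mul_pos (pow_pos hR 2) (pow_pos (norm_pos_iff.2 hv0) 2)
  have hcone := cone_intWindow W h0 h1 hm1 d s Λ |g₁| Δ γ R t₀ (t₀ + τ) g v hγ hγ0 hΔ hΛ hg hR htrap hsupp hderiv
    hinit (t₀ + τ) ht₁mem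
  have hn0 : 0 < ‖v (t₀ + τ) 0‖ := hcone.2
  have hv1 : v (t₀ + τ) 0 ≠ 0 := norm_pos_iff.1 hn0
  -- abbreviations
  set Q : ℝ := |g₁| * R * (2 + γ * R) / Δ with hQdef
  have hQ0 : 0 ≤ Q := by rw [hQdef]; positivity
  set prof : ℤ → ℂ := fun I => if I = 1 then -(Λ : ℂ) * (s 0 : ℂ) * ((g₁ * J (Λ * (d 1 - d 0)) (t₀ + τ - t₀) : ℝ) : ℂ)
    else if I = -1 then (Λ : ℂ) * (s (-1) : ℂ) * ((g₁ * J (Λ * (d (-1) - d 0)) (t₀ + τ - t₀) : ℝ) : ℂ) else 0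
    with hprof
  have hrem' : ∑ J ∈ W.erase 0, ‖v (t₀ + τ) J / v (t₀ + τ) 0 - prof J‖ ^ 2 ≤ Q ^ 2 := by
    simpa only [hprof, hQdef] using hrem
  -- (i) factor out `‖v_0‖`
  have hfac : Real.sqrt (∑ J ∈ W.erase 0, ‖v (t₀ + τ) J‖ ^ 2) =
      Real.sqrt (∑ J ∈ W.erase 0, ‖v (t₀ + τ) J / v (t₀ + τ) 0‖ ^ 2) * ‖v (t₀ + τ) 0‖ := by
    have e : ∑ J ∈ W.erase 0, ‖v (t₀ + τ) J‖ ^ 2 =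
        (∑ J ∈ W.erase 0, ‖v (t₀ + τ) J / v (t₀ + τ) 0‖ ^ 2) * ‖v (t₀ + τ) 0‖ ^ 2 := by
      rw [Finset.sum_mul]
      refine Finset.sum_congr rfl fun J _ => ?_
      rw [norm_div, div_pow, div_mul_cancel₀ _ (pow_ne_zero 2 hn0.ne')]
    rw [e, Real.sqrt_mul (Finset.sum_nonneg fun J _ => sq_nonneg _), Real.sqrt_sq hn0.le]
  -- (ii) Minkowski: ratios ≤ (ratios − profile) + profile
  have hmink : Real.sqrt (∑ J ∈ W.erase 0, ‖v (t₀ + τ) J / v (t₀ + τ) 0‖ ^ 2) ≤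
      Real.sqrt (∑ J ∈ W.erase 0, ‖v (t₀ + τ) J / v (t₀ + τ) 0 - prof J‖ ^ 2) +
        Real.sqrt (∑ J ∈ W.erase 0, ‖prof J‖ ^ 2) := by
    refine le_trans (Real.sqrt_le_sqrt (Finset.sum_le_sum fun J _ => ?_))
      (sqrt_sum_add_sq_le (W.erase 0) (fun J => ‖v (t₀ + τ) J / v (t₀ + τ) 0 - prof J‖) (fun J => ‖prof J‖))
    have h := norm_add_le (v (t₀ + τ) J / v (t₀ + τ) 0 - prof J) (prof J)
    rw [sub_add_cancel] at h
    exact pow_le_pow_left₀ (norm_nonneg _) h 2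
  -- (iii) the profile's size
  have hprof_le : Real.sqrt (∑ J ∈ W.erase 0, ‖prof J‖ ^ 2) ≤
      |g₁| / (Λ * ρ * τ) * (|s 0| / (d 1 - d 0) ^ 2 + |s (-1)| / (d (-1) - d 0) ^ 2) := by
    -- only `J = ±1` contribute
    have hm1' : (-1 : ℤ) ∈ W.erase 0 := Finset.mem_erase.2 ⟨by norm_num, hm1⟩
    have h1' : (1 : ℤ) ∈ (W.erase 0).erase (-1) :=
      Finset.mem_erase.2 ⟨by norm_num, Finset.mem_erase.2 ⟨by norm_num, h1⟩⟩
    have hsum : ∑ J ∈ W.erase 0, ‖prof J‖ ^ 2 = ‖prof (-1)‖ ^ 2 + ‖prof 1‖ ^ 2 := by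
      rw [← Finset.add_sum_erase _ _ hm1', ← Finset.add_sum_erase _ _ h1']
      have hrest : ∑ J ∈ ((W.erase 0).erase (-1)).erase 1, ‖prof J‖ ^ 2 = 0 := by
        refine Finset.sum_eq_zero fun J hJ => ?_
        have hJ1 : J ≠ 1 := Finset.ne_of_mem_erase hJ
        have hJ2 : J ≠ -1 := Finset.ne_of_mem_erase (Finset.mem_of_mem_erase hJ)
        simp [hprof, hJ1, hJ2]
      rw [hrest, add_zero]
    have hpm : ‖prof (-1)‖ = Λ * |s (-1)| * (|g₁| * |J (Λ * (d (-1) - d 0)) (t₀ + τ - t₀)|) := by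
      simp only [hprof, show (-1 : ℤ) ≠ 1 by norm_num, if_false, if_true, norm_mul, Complex.norm_real,
        Real.norm_eq_abs, abs_of_pos hΛ]
    have hpp : ‖prof 1‖ = Λ * |s 0| * (|g₁| * |J (Λ * (d 1 - d 0)) (t₀ + τ - t₀)|) := by
      simp only [hprof, if_true, norm_mul, norm_neg, Complex.norm_real, Real.norm_eq_abs, abs_of_pos hΛ]
    have hA : ‖prof (-1)‖ ≤ |g₁| / (Λ * ρ * τ) * (|s (-1)| / (d (-1) - d 0) ^ 2) := by
      rw [hpm]
      calc Λ * |s (-1)| * (|g₁| * |J (Λ * (d (-1) - d 0)) (t₀ + τ - t₀)|)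
          ≤ Λ * |s (-1)| * (|g₁| * (1 / (ρ * τ * (Λ * (d (-1) - d 0)) ^ 2))) :=
            mul_le_mul_of_nonneg_left (mul_le_mul_of_nonneg_left (hJend _ hlm0) (abs_nonneg _)) (by positivity)
        _ = |g₁| / (Λ * ρ * τ) * (|s (-1)| / (d (-1) - d 0) ^ 2) := by
            field_simp
    have hB : ‖prof 1‖ ≤ |g₁| / (Λ * ρ * τ) * (|s 0| / (d 1 - d 0) ^ 2) := by
      rw [hpp]
      calc Λ * |s 0| * (|g₁| * |J (Λ * (d 1 - d 0)) (t₀ + τ - t₀)|)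
          ≤ Λ * |s 0| * (|g₁| * (1 / (ρ * τ * (Λ * (d 1 - d 0)) ^ 2))) :=
            mul_le_mul_of_nonneg_left (mul_le_mul_of_nonneg_left (hJend _ hlp0) (abs_nonneg _)) (by positivity)
        _ = |g₁| / (Λ * ρ * τ) * (|s 0| / (d 1 - d 0) ^ 2) := by
            field_simp
    rw [hsum]
    have hsq : ‖prof (-1)‖ ^ 2 + ‖prof 1‖ ^ 2 ≤ (‖prof (-1)‖ + ‖prof 1‖) ^ 2 := by
      nlinarith [norm_nonneg (prof (-1)), norm_nonneg (prof 1)]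
    calc Real.sqrt (‖prof (-1)‖ ^ 2 + ‖prof 1‖ ^ 2) ≤ Real.sqrt ((‖prof (-1)‖ + ‖prof 1‖) ^ 2) :=
          Real.sqrt_le_sqrt hsq
      _ = ‖prof (-1)‖ + ‖prof 1‖ := Real.sqrt_sq (by positivity)
      _ ≤ _ := by
          have := add_le_add hA hB
          linarith
  -- assemble
  have hfirst : Real.sqrt (∑ J ∈ W.erase 0, ‖v (t₀ + τ) J / v (t₀ + τ) 0 - prof J‖ ^ 2) ≤ Q :=
    (Real.sqrt_le_sqrt hrem').trans (le_of_eq (Real.sqrt_sq hQ0))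
  rw [hfac]
  exact mul_le_mul_of_nonneg_right ((hmink.trans (add_le_add hfirst hprof_le))) hn0.le

/-! ## §3 Same-direction pairs: two consecutive trapezoid slots on one ladder

Two consecutive slots with the SAME direction (same coset, same ladder `d, s`) and different amplitudes give the
coupling `g(t) = c₁·trapezoid 0 τ₁ ρ (t − t₀) + c₂·trapezoid τ₁ τ₂ ρ (t − t₀)` on `[t₀, t₀ + τ₁ + τ₂]`; the realised
weight of the pair is `(c₁²τ₁ + c₂²τ₂)(1 − 4ρ/3)` up to each hump's lag and ONE third-order cross term
(`abs_mul_integral_pair_duhamel_sub_le`). -/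

/-- The pair envelope is continuous. [folklore] -/
private theorem continuous_pairEnvelope (τ₁ τ₂ ρ c₁ c₂ : ℝ) :
    Continuous fun x => c₁ * LatticeWord.trapezoid 0 τ₁ ρ x + c₂ * LatticeWord.trapezoid τ₁ τ₂ ρ x := by
  unfold LatticeWord.trapezoid; fun_prop

/-- `|c₁ a₁ + c₂ a₂| ≤ c` when `|c₁|, |c₂| ≤ c`: the two humps have disjoint supports. [folklore] -/
private theorem abs_pairEnvelope_le {τ₁ τ₂ ρ c₁ c₂ c : ℝ} (hτ₁ : 0 < τ₁) (hτ₂ : 0 < τ₂) (hρ : 0 < ρ)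
    (hc₁ : |c₁| ≤ c) (hc₂ : |c₂| ≤ c) (x : ℝ) :
    |c₁ * LatticeWord.trapezoid 0 τ₁ ρ x + c₂ * LatticeWord.trapezoid τ₁ τ₂ ρ x| ≤ c := by
  have hc : 0 ≤ c := (abs_nonneg _).trans hc₁
  have m1 := unitTrapezoid_mem_Icc τ₁ ρ x
  have m2 := unitTrapezoid_mem_Icc τ₂ ρ (x - τ₁)
  rw [trapezoid_shift τ₁ τ₂ ρ x]
  rcases le_total x τ₁ with hx | hx
  · rw [trapezoid_eq_zero_of_nonpos hτ₂ hρ (by linarith : x - τ₁ ≤ 0), mul_zero, add_zero, abs_mul]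
    calc |c₁| * |LatticeWord.trapezoid 0 τ₁ ρ x| ≤ c * 1 :=
          mul_le_mul hc₁ (abs_le.2 ⟨by linarith [m1.1], m1.2⟩) (abs_nonneg _) hc
      _ = c := mul_one c
  · rw [trapezoid_eq_zero_of_tau_le hτ₁ hρ hx, mul_zero, zero_add, abs_mul]
    calc |c₂| * |LatticeWord.trapezoid 0 τ₂ ρ (x - τ₁)| ≤ c * 1 :=
          mul_le_mul hc₂ (abs_le.2 ⟨by linarith [m2.1], m2.2⟩) (abs_nonneg _) hc
      _ = c := mul_one c

/-- End value of the pair's Duhamel response: `|J_λ[c₁a₁ + c₂a₂](τ₁+τ₂)| ≤ |c₁|/(ρτ₁λ²) + |c₂|/(ρτ₂λ²)` — the first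
hump has decayed freely since `τ₁` (`duhamel_eq_exp_mul_of_eq_zero`), the second has just ramped down
(`duhamel_trapezoid_end_le`). [folklore] -/
private theorem abs_duhamel_pair_end_le {τ₁ τ₂ ρ lam : ℝ} (hτ₁ : 0 < τ₁) (hτ₂ : 0 < τ₂) (hρ : 0 < ρ)
    (hlam : 0 < lam) (c₁ c₂ : ℝ) :
    |Real.exp (-lam * (τ₁ + τ₂)) * ∫ y in (0:ℝ)..(τ₁ + τ₂), Real.exp (lam * y) *
        (c₁ * LatticeWord.trapezoid 0 τ₁ ρ y + c₂ * LatticeWord.trapezoid τ₁ τ₂ ρ y)|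
      ≤ |c₁| * (1 / (ρ * τ₁ * lam ^ 2)) + |c₂| * (1 / (ρ * τ₂ * lam ^ 2)) := by
  have he : Continuous fun y => Real.exp (lam * y) := by fun_prop
  have ht1 := continuous_unitTrapezoid τ₁ ρ
  have ht2 : Continuous fun y => LatticeWord.trapezoid τ₁ τ₂ ρ y := by
    unfold LatticeWord.trapezoid; fun_prop
  -- linearity of the response in the envelope
  have hlin : Real.exp (-lam * (τ₁ + τ₂)) * ∫ y in (0:ℝ)..(τ₁ + τ₂), Real.exp (lam * y) *
        (c₁ * LatticeWord.trapezoid 0 τ₁ ρ y + c₂ * LatticeWord.trapezoid τ₁ τ₂ ρ y)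
      = c₁ * (Real.exp (-lam * (τ₁ + τ₂)) *
          ∫ y in (0:ℝ)..(τ₁ + τ₂), Real.exp (lam * y) * LatticeWord.trapezoid 0 τ₁ ρ y)
        + c₂ * (Real.exp (-lam * (τ₁ + τ₂)) *
          ∫ y in (0:ℝ)..(τ₁ + τ₂), Real.exp (lam * y) * LatticeWord.trapezoid τ₁ τ₂ ρ y) := by
    have h1 : IntervalIntegrable (fun y => Real.exp (lam * y) * LatticeWord.trapezoid 0 τ₁ ρ y)
        volume 0 (τ₁ + τ₂) := (he.mul ht1).intervalIntegrable _ _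
    have h2 : IntervalIntegrable (fun y => Real.exp (lam * y) * LatticeWord.trapezoid τ₁ τ₂ ρ y)
        volume 0 (τ₁ + τ₂) := (he.mul ht2).intervalIntegrable _ _
    have e : ∫ y in (0:ℝ)..(τ₁ + τ₂), Real.exp (lam * y) *
        (c₁ * LatticeWord.trapezoid 0 τ₁ ρ y + c₂ * LatticeWord.trapezoid τ₁ τ₂ ρ y)
        = c₁ * (∫ y in (0:ℝ)..(τ₁ + τ₂), Real.exp (lam * y) * LatticeWord.trapezoid 0 τ₁ ρ y)
          + c₂ * (∫ y in (0:ℝ)..(τ₁ + τ₂), Real.exp (lam * y) * LatticeWord.trapezoid τ₁ τ₂ ρ y) := by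
      rw [← intervalIntegral.integral_const_mul, ← intervalIntegral.integral_const_mul,
        ← intervalIntegral.integral_add (h1.const_mul c₁) (h2.const_mul c₂)]
      exact intervalIntegral.integral_congr fun y _ => by ring
    rw [e]; ring
  -- first hump: free decay after `τ₁`
  have hA0 : 0 ≤ Real.exp (-lam * τ₁) *
      ∫ y in (0:ℝ)..τ₁, Real.exp (lam * y) * LatticeWord.trapezoid 0 τ₁ ρ y :=
    duhamel_nonneg (fun x => (unitTrapezoid_mem_Icc τ₁ ρ x).1) hτ₁.le
  have hA : |Real.exp (-lam * (τ₁ + τ₂)) *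
      ∫ y in (0:ℝ)..(τ₁ + τ₂), Real.exp (lam * y) * LatticeWord.trapezoid 0 τ₁ ρ y| ≤ 1 / (ρ * τ₁ * lam ^ 2) := by
    rw [duhamel_eq_exp_mul_of_eq_zero ht1 (show τ₁ ≤ τ₁ + τ₂ by linarith)
      (fun y hy => trapezoid_eq_zero_of_tau_le hτ₁ hρ hy.1)]
    rw [abs_mul, abs_of_pos (Real.exp_pos _), abs_of_nonneg hA0]
    have hexp : Real.exp (-lam * (τ₁ + τ₂ - τ₁)) ≤ 1 := Real.exp_le_one_iff.2 (by nlinarith)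
    calc Real.exp (-lam * (τ₁ + τ₂ - τ₁)) *
          (Real.exp (-lam * τ₁) * ∫ y in (0:ℝ)..τ₁, Real.exp (lam * y) * LatticeWord.trapezoid 0 τ₁ ρ y)
        ≤ 1 * (Real.exp (-lam * τ₁) * ∫ y in (0:ℝ)..τ₁, Real.exp (lam * y) * LatticeWord.trapezoid 0 τ₁ ρ y) :=
          mul_le_mul_of_nonneg_right hexp hA0
      _ ≤ 1 / (ρ * τ₁ * lam ^ 2) := by rw [one_mul]; exact duhamel_trapezoid_end_le hτ₁ hρ hlam
  -- second hump: shift to slot-local time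
  have hB : |Real.exp (-lam * (τ₁ + τ₂)) *
      ∫ y in (0:ℝ)..(τ₁ + τ₂), Real.exp (lam * y) * LatticeWord.trapezoid τ₁ τ₂ ρ y| ≤ 1 / (ρ * τ₂ * lam ^ 2) := by
    have hsplit : ∫ y in (0:ℝ)..(τ₁ + τ₂), Real.exp (lam * y) * LatticeWord.trapezoid τ₁ τ₂ ρ y
        = (∫ y in (0:ℝ)..τ₁, Real.exp (lam * y) * LatticeWord.trapezoid τ₁ τ₂ ρ y)
          + ∫ y in τ₁..(τ₁ + τ₂), Real.exp (lam * y) * LatticeWord.trapezoid τ₁ τ₂ ρ y :=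
      (intervalIntegral.integral_add_adjacent_intervals ((he.mul ht2).intervalIntegrable _ _)
        ((he.mul ht2).intervalIntegrable _ _)).symm
    have hzero : ∫ y in (0:ℝ)..τ₁, Real.exp (lam * y) * LatticeWord.trapezoid τ₁ τ₂ ρ y = 0 := by
      have h : EqOn (fun y => Real.exp (lam * y) * LatticeWord.trapezoid τ₁ τ₂ ρ y) (fun _ => 0) (uIcc 0 τ₁) := by
        intro y hy
        rw [uIcc_of_le hτ₁.le] at hy
        have hz : LatticeWord.trapezoid τ₁ τ₂ ρ y = 0 := by
          rw [trapezoid_shift τ₁ τ₂ ρ y]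
          exact trapezoid_eq_zero_of_nonpos hτ₂ hρ (by linarith [hy.2])
        simp only [hz, mul_zero]
      rw [intervalIntegral.integral_congr h]; simp
    have hshift : ∫ y in τ₁..(τ₁ + τ₂), Real.exp (lam * y) * LatticeWord.trapezoid τ₁ τ₂ ρ y
        = Real.exp (lam * τ₁) * ∫ u in (0:ℝ)..τ₂, Real.exp (lam * u) * LatticeWord.trapezoid 0 τ₂ ρ u := by
      have h := intervalIntegral.integral_comp_sub_right
        (fun u => Real.exp (lam * (u + τ₁)) * LatticeWord.trapezoid 0 τ₂ ρ u) τ₁ (a := τ₁) (b := τ₁ + τ₂)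
      simp only [sub_self, sub_add_cancel, add_sub_cancel_left] at h
      have e1 : ∫ y in τ₁..(τ₁ + τ₂), Real.exp (lam * y) * LatticeWord.trapezoid τ₁ τ₂ ρ y
          = ∫ y in τ₁..(τ₁ + τ₂), Real.exp (lam * y) * LatticeWord.trapezoid 0 τ₂ ρ (y - τ₁) :=
        intervalIntegral.integral_congr fun y _ => by rw [trapezoid_shift τ₁ τ₂ ρ y]
      rw [e1, h, ← intervalIntegral.integral_const_mul]
      exact intervalIntegral.integral_congr fun u _ => by rw [mul_add, Real.exp_add]; ring
    rw [hsplit, hzero, zero_add, hshift, ← mul_assoc, ← Real.exp_add,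
      show -lam * (τ₁ + τ₂) + lam * τ₁ = -lam * τ₂ by ring]
    have hB0 : 0 ≤ Real.exp (-lam * τ₂) *
        ∫ u in (0:ℝ)..τ₂, Real.exp (lam * u) * LatticeWord.trapezoid 0 τ₂ ρ u :=
      duhamel_nonneg (fun x => (unitTrapezoid_mem_Icc τ₂ ρ x).1) hτ₂.le
    rw [abs_of_nonneg hB0]
    exact duhamel_trapezoid_end_le hτ₂ hρ hlam
  rw [hlin]
  calc _ ≤ |c₁ * (Real.exp (-lam * (τ₁ + τ₂)) *
            ∫ y in (0:ℝ)..(τ₁ + τ₂), Real.exp (lam * y) * LatticeWord.trapezoid 0 τ₁ ρ y)|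
          + |c₂ * (Real.exp (-lam * (τ₁ + τ₂)) *
            ∫ y in (0:ℝ)..(τ₁ + τ₂), Real.exp (lam * y) * LatticeWord.trapezoid τ₁ τ₂ ρ y)| := abs_add_le _ _
    _ ≤ _ := by
        rw [abs_mul c₁, abs_mul c₂]
        exact add_le_add (mul_le_mul_of_nonneg_left hA (abs_nonneg _))
          (mul_le_mul_of_nonneg_left hB (abs_nonneg _))

/-- **The slot-column law for a same-direction PAIR of trapezoid slots, closed form.** As `column_law_trapezoid`, but
with the coupling `g(t) = c₁·trapezoid 0 τ₁ ρ (t − t₀) + c₂·trapezoid τ₁ τ₂ ρ (t − t₀)` on `[t₀, t₀ + τ₁ + τ₂]`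
(`|c₁|, |c₂| ≤ c`, cone condition `c γ (1 + R²) < Δ R`, `Q = c R (2 + γR)/Δ`). For the column datum:
`|log ‖v_0(t₀+τ₁+τ₂)‖² − log ‖v_0(t₀)‖² + 2Λ d_0 (τ₁+τ₂) + 2Λ (c₁²τ₁ + c₂²τ₂)(1 − 4ρ/3)(s 0²/δ₊ + s(−1)²/δ₋)|`
`≤ 2ΛcγQ(τ₁+τ₂) + 2Λ Σ_± (s_±²/δ_±)·(2c₁²/(ρτ₁λ_±²) + 2c₂²/(ρτ₂λ_±²) + |c₁c₂|/(ρ²τ₁τ₂λ_±³))`, `λ_± = Λδ_±`: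
the two humps add their quasi-static weights; the only interaction is the third-order cross term.
[cite: Eastham1989, §1.5 Thm 1.5.1 (1.5.5), §1.6 Thm 1.6.1] [cite: MajdaKramer1999, §2.2.1.3 (55)]
[cite: KokotovicBensoussanBlankenship1987, Kokotović §2 Thm 2.3 (2.40)] -/
theorem column_law_trapezoidPair (W : Finset ℤ) (h0 : (0 : ℤ) ∈ W) (h1 : (1 : ℤ) ∈ W) (hm1 : (-1 : ℤ) ∈ W)
    (d s : ℤ → ℝ) (Λ Δ γ R t₀ τ₁ τ₂ ρ c₁ c₂ c : ℝ) (g : ℝ → ℝ) (v : ℝ → ℤ → ℂ)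
    (hs : ∀ J ∈ W, |s J| ≤ 1) (hγ : γ ^ 2 = s 0 ^ 2 + s (-1) ^ 2) (hγ0 : 0 ≤ γ)
    (hΔ : ∀ J ∈ W, J ≠ 0 → d 0 + Δ ≤ d J) (hΔ0 : 0 < Δ) (hΛ : 0 < Λ)
    (hτ₁ : 0 < τ₁) (hτ₂ : 0 < τ₂) (hρ : 0 < ρ) (hρ2 : ρ ≤ 1 / 2) (hc₁ : |c₁| ≤ c) (hc₂ : |c₂| ≤ c)
    (hR : 0 < R) (htrap : c * γ * (1 + R ^ 2) < Δ * R)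
    (hgdef : ∀ t ∈ Icc t₀ (t₀ + (τ₁ + τ₂)), g t =
      c₁ * LatticeWord.trapezoid 0 τ₁ ρ (t - t₀) + c₂ * LatticeWord.trapezoid τ₁ τ₂ ρ (t - t₀))
    (hsupp : ∀ t ∈ Icc t₀ (t₀ + (τ₁ + τ₂)), ∀ J, J ∉ W → v t J = 0)
    (hderiv : ∀ t ∈ Icc t₀ (t₀ + (τ₁ + τ₂)), ∀ J ∈ W, HasDerivWithinAt (fun t' => v t' J)
        (-(Λ : ℂ) * ((d J : ℂ) * v t J) - (g t : ℂ) * (Λ : ℂ) * ((s (J - 1) : ℂ) * v t (J - 1) - (s J : ℂ) * v t (J + 1)))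
        (Icc t₀ (t₀ + (τ₁ + τ₂))) t)
    (hcol : ∀ J, J ≠ 0 → v t₀ J = 0) (hv0 : v t₀ 0 ≠ 0) :
    |Real.log (‖v (t₀ + (τ₁ + τ₂)) 0‖ ^ 2) - Real.log (‖v t₀ 0‖ ^ 2) + 2 * Λ * d 0 * (τ₁ + τ₂) +
        2 * Λ * ((c₁ ^ 2 * τ₁ + c₂ ^ 2 * τ₂) * (1 - 4 * ρ / 3)) *
          (s 0 ^ 2 / (d 1 - d 0) + s (-1) ^ 2 / (d (-1) - d 0))|
      ≤ 2 * Λ * c * γ * (c * R * (2 + γ * R) / Δ) * (τ₁ + τ₂) +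
        2 * Λ * (s 0 ^ 2 / (d 1 - d 0) *
            (2 * c₁ ^ 2 / (ρ * τ₁ * (Λ * (d 1 - d 0)) ^ 2) + 2 * c₂ ^ 2 / (ρ * τ₂ * (Λ * (d 1 - d 0)) ^ 2) +
              |c₁ * c₂| / (ρ ^ 2 * τ₁ * τ₂ * (Λ * (d 1 - d 0)) ^ 3)) +
          s (-1) ^ 2 / (d (-1) - d 0) *
            (2 * c₁ ^ 2 / (ρ * τ₁ * (Λ * (d (-1) - d 0)) ^ 2) + 2 * c₂ ^ 2 / (ρ * τ₂ * (Λ * (d (-1) - d 0)) ^ 2) +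
              |c₁ * c₂| / (ρ ^ 2 * τ₁ * τ₂ * (Λ * (d (-1) - d 0)) ^ 3))) := by
  have hδp0 : 0 < d 1 - d 0 := by have := hΔ 1 h1 one_ne_zero; linarith
  have hδm0 : 0 < d (-1) - d 0 := by have := hΔ (-1) hm1 (by norm_num); linarith
  have hlp0 : 0 < Λ * (d 1 - d 0) := mul_pos hΛ hδp0
  have hlm0 : 0 < Λ * (d (-1) - d 0) := mul_pos hΛ hδm0
  have hT0 : 0 < τ₁ + τ₂ := by linarith
  have hc0 : 0 ≤ c := (abs_nonneg _).trans hc₁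
  have ht₁mem : t₀ + (τ₁ + τ₂) ∈ Icc t₀ (t₀ + (τ₁ + τ₂)) := right_mem_Icc.2 (by linarith)
  -- the pair envelope and its Duhamel responses (slot-local time)
  set a : ℝ → ℝ := fun x => c₁ * LatticeWord.trapezoid 0 τ₁ ρ x + c₂ * LatticeWord.trapezoid τ₁ τ₂ ρ x with hadef
  have ha : Continuous a := continuous_pairEnvelope τ₁ τ₂ ρ c₁ c₂
  set J : ℝ → ℝ → ℝ := fun lam x => Real.exp (-lam * x) * ∫ y in (0:ℝ)..x, Real.exp (lam * y) * a y
    with hJdef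
  have hJ : ∀ lam x, HasDerivAt (J lam) (a x - lam * J lam x) x := fun lam x => by
    simp only [hJdef]; exact hasDerivAt_duhamel ha lam x
  have hJc : ∀ lam, Continuous (J lam) := fun lam =>
    continuous_iff_continuousAt.2 fun x => (hJ lam x).continuousAt
  have hJ0 : ∀ lam, J lam 0 = 0 := fun lam => by
    simp only [hJdef, intervalIntegral.integral_same, mul_zero]
  set K : ℝ → ℝ → ℝ := fun lam x => ∫ y in (0:ℝ)..x, a y * J lam y with hKdef
  have hK : ∀ lam x, HasDerivAt (K lam) (a x * J lam x) x := fun lam x => by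
    simp only [hKdef]
    exact ((ha.mul (hJc lam)).integral_hasStrictDerivAt 0 x).hasDerivAt
  have hK0 : ∀ lam, K lam 0 = 0 := fun lam => by simp only [hKdef, intervalIntegral.integral_same]
  have hshift : ∀ t, HasDerivAt (fun t => t - t₀) 1 t := fun t => (hasDerivAt_id t).sub_const t₀
  have hga : ∀ t ∈ Icc t₀ (t₀ + (τ₁ + τ₂)), g t = a (t - t₀) := fun t ht => by rw [hgdef t ht]
  have hjd : ∀ lam, ∀ t ∈ Icc t₀ (t₀ + (τ₁ + τ₂)), HasDerivWithinAt (fun t => J lam (t - t₀))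
      (g t - lam * J lam (t - t₀)) (Icc t₀ (t₀ + (τ₁ + τ₂))) t := by
    intro lam t ht
    have h := (hJ lam (t - t₀)).comp t (hshift t)
    refine (h.congr_deriv ?_).hasDerivWithinAt
    rw [hga t ht]
    ring
  have hΦd : ∀ t ∈ Icc t₀ (t₀ + (τ₁ + τ₂)), HasDerivWithinAt
      (fun t => Λ * (s 0 ^ 2 * K (Λ * (d 1 - d 0)) (t - t₀) + s (-1) ^ 2 * K (Λ * (d (-1) - d 0)) (t - t₀)))
      (Λ * g t * (s 0 ^ 2 * J (Λ * (d 1 - d 0)) (t - t₀) + s (-1) ^ 2 * J (Λ * (d (-1) - d 0)) (t - t₀)))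
      (Icc t₀ (t₀ + (τ₁ + τ₂))) t := by
    intro t ht
    have hp := ((hK (Λ * (d 1 - d 0)) (t - t₀)).comp t (hshift t)).const_mul (s 0 ^ 2)
    have hm := ((hK (Λ * (d (-1) - d 0)) (t - t₀)).comp t (hshift t)).const_mul (s (-1) ^ 2)
    have h := (hp.add hm).const_mul Λ
    refine (h.congr_deriv ?_).hasDerivWithinAt
    rw [hga t ht]
    ring
  have hg : ∀ t ∈ Ioo t₀ (t₀ + (τ₁ + τ₂)), |g t| ≤ c := by
    intro t ht
    rw [hgdef t (Ioo_subset_Icc_self ht)]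
    exact abs_pairEnvelope_le hτ₁ hτ₂ hρ hc₁ hc₂ (t - t₀)
  -- the two-sided column law with these responses, at the end of the pair
  have key := column_law_intWindow W h0 h1 hm1 d s Λ c Δ γ R t₀ (t₀ + (τ₁ + τ₂)) g
    (fun t => Λ * (s 0 ^ 2 * K (Λ * (d 1 - d 0)) (t - t₀) + s (-1) ^ 2 * K (Λ * (d (-1) - d 0)) (t - t₀)))
    (fun t => J (Λ * (d 1 - d 0)) (t - t₀)) (fun t => J (Λ * (d (-1) - d 0)) (t - t₀)) v
    hs hγ hγ0 hΔ hΔ0 hΛ hg hc0 hR htrap hsupp hderiv hcol hv0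
    (hjd (Λ * (d 1 - d 0))) (by simp only [sub_self, hJ0])
    (hjd (Λ * (d (-1) - d 0))) (by simp only [sub_self, hJ0]) hΦd (t₀ + (τ₁ + τ₂)) ht₁mem
  simp only [sub_self, hK0, mul_zero, add_zero, sub_zero, add_sub_cancel_left] at key
  -- realised weights of the pair
  have hE : ∀ lam, 0 < lam → |lam * K lam (τ₁ + τ₂) - (c₁ ^ 2 * τ₁ + c₂ ^ 2 * τ₂) * (1 - 4 * ρ / 3)|
      ≤ 2 * c₁ ^ 2 / (ρ * τ₁ * lam ^ 2) + 2 * c₂ ^ 2 / (ρ * τ₂ * lam ^ 2) +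
        |c₁ * c₂| / (ρ ^ 2 * τ₁ * τ₂ * lam ^ 3) := by
    intro lam hlam
    have h := abs_mul_integral_pair_duhamel_sub_le hτ₁ hτ₂ hρ hρ2 hlam c₁ c₂
    simp only [hKdef, hJdef, hadef]
    exact h
  have hdec : ∀ lam, 0 < lam → ∃ E, K lam (τ₁ + τ₂) = ((c₁ ^ 2 * τ₁ + c₂ ^ 2 * τ₂) * (1 - 4 * ρ / 3) + E) / lam ∧
      |E| ≤ 2 * c₁ ^ 2 / (ρ * τ₁ * lam ^ 2) + 2 * c₂ ^ 2 / (ρ * τ₂ * lam ^ 2) +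
        |c₁ * c₂| / (ρ ^ 2 * τ₁ * τ₂ * lam ^ 3) :=
    fun lam hlam => ⟨lam * K lam (τ₁ + τ₂) - (c₁ ^ 2 * τ₁ + c₂ ^ 2 * τ₂) * (1 - 4 * ρ / 3),
      by field_simp; ring, hE lam hlam⟩
  obtain ⟨Ep, hKp, hEp⟩ := hdec (Λ * (d 1 - d 0)) hlp0
  obtain ⟨Em, hKm, hEm⟩ := hdec (Λ * (d (-1) - d 0)) hlm0
  rw [hKp, hKm] at key
  have hsplit : Real.log (‖v (t₀ + (τ₁ + τ₂)) 0‖ ^ 2) - Real.log (‖v t₀ 0‖ ^ 2) + 2 * Λ * d 0 * (τ₁ + τ₂) +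
      2 * Λ * ((c₁ ^ 2 * τ₁ + c₂ ^ 2 * τ₂) * (1 - 4 * ρ / 3)) *
        (s 0 ^ 2 / (d 1 - d 0) + s (-1) ^ 2 / (d (-1) - d 0)) =
      (Real.log (‖v (t₀ + (τ₁ + τ₂)) 0‖ ^ 2) - Real.log (‖v t₀ 0‖ ^ 2) + 2 * Λ * d 0 * (τ₁ + τ₂) +
        2 * Λ * (Λ * (s 0 ^ 2 * (((c₁ ^ 2 * τ₁ + c₂ ^ 2 * τ₂) * (1 - 4 * ρ / 3) + Ep) / (Λ * (d 1 - d 0))) +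
          s (-1) ^ 2 * (((c₁ ^ 2 * τ₁ + c₂ ^ 2 * τ₂) * (1 - 4 * ρ / 3) + Em) / (Λ * (d (-1) - d 0)))))) -
      2 * Λ * (s 0 ^ 2 * Ep / (d 1 - d 0) + s (-1) ^ 2 * Em / (d (-1) - d 0)) := by
    field_simp
    ring
  have h2nd : |2 * Λ * (s 0 ^ 2 * Ep / (d 1 - d 0) + s (-1) ^ 2 * Em / (d (-1) - d 0))| ≤
      2 * Λ * (s 0 ^ 2 / (d 1 - d 0) *
          (2 * c₁ ^ 2 / (ρ * τ₁ * (Λ * (d 1 - d 0)) ^ 2) + 2 * c₂ ^ 2 / (ρ * τ₂ * (Λ * (d 1 - d 0)) ^ 2) +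
            |c₁ * c₂| / (ρ ^ 2 * τ₁ * τ₂ * (Λ * (d 1 - d 0)) ^ 3)) +
        s (-1) ^ 2 / (d (-1) - d 0) *
          (2 * c₁ ^ 2 / (ρ * τ₁ * (Λ * (d (-1) - d 0)) ^ 2) + 2 * c₂ ^ 2 / (ρ * τ₂ * (Λ * (d (-1) - d 0)) ^ 2) +
            |c₁ * c₂| / (ρ ^ 2 * τ₁ * τ₂ * (Λ * (d (-1) - d 0)) ^ 3))) := by
    rw [abs_mul, abs_of_nonneg (by positivity : 0 ≤ 2 * Λ)]
    refine mul_le_mul_of_nonneg_left ((abs_add_le _ _).trans (add_le_add ?_ ?_)) (by positivity)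
    · rw [abs_div, abs_mul, abs_of_nonneg (sq_nonneg _), abs_of_pos hδp0]
      calc s 0 ^ 2 * |Ep| / (d 1 - d 0) ≤ s 0 ^ 2 * (2 * c₁ ^ 2 / (ρ * τ₁ * (Λ * (d 1 - d 0)) ^ 2) +
            2 * c₂ ^ 2 / (ρ * τ₂ * (Λ * (d 1 - d 0)) ^ 2) + |c₁ * c₂| / (ρ ^ 2 * τ₁ * τ₂ * (Λ * (d 1 - d 0)) ^ 3)) /
            (d 1 - d 0) :=
            div_le_div_of_nonneg_right (mul_le_mul_of_nonneg_left hEp (sq_nonneg _)) hδp0.le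
        _ = _ := by ring
    · rw [abs_div, abs_mul, abs_of_nonneg (sq_nonneg _), abs_of_pos hδm0]
      calc s (-1) ^ 2 * |Em| / (d (-1) - d 0) ≤ s (-1) ^ 2 * (2 * c₁ ^ 2 / (ρ * τ₁ * (Λ * (d (-1) - d 0)) ^ 2) +
            2 * c₂ ^ 2 / (ρ * τ₂ * (Λ * (d (-1) - d 0)) ^ 2) +
            |c₁ * c₂| / (ρ ^ 2 * τ₁ * τ₂ * (Λ * (d (-1) - d 0)) ^ 3)) / (d (-1) - d 0) :=
            div_le_div_of_nonneg_right (mul_le_mul_of_nonneg_left hEm (sq_nonneg _)) hδm0.le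
        _ = _ := by ring
  rw [hsplit]
  exact (abs_sub _ _).trans (add_le_add key h2nd)

/-- **End-of-pair fast residual of the column.** Under the hypotheses of `column_law_trapezoidPair` (without `hρ2`), at
the end `t₀ + τ₁ + τ₂` of the pair
`√(Σ_{J≠0} ‖v_J‖²) ≤ (Q + ((|c₁|/(ρτ₁) + |c₂|/(ρτ₂))/Λ)·(|s 0|/δ₊² + |s(−1)|/δ₋²))·‖v_0‖`, `Q = c R (2 + γR)/Δ`.
[cite: Eastham1989, §1.5 Thm 1.5.1, (1.5.8)–(1.5.10)] [cite: MajdaKramer1999, §2.2.1.3 (55)] -/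
theorem column_residual_trapezoidPair (W : Finset ℤ) (h0 : (0 : ℤ) ∈ W) (h1 : (1 : ℤ) ∈ W) (hm1 : (-1 : ℤ) ∈ W)
    (d s : ℤ → ℝ) (Λ Δ γ R t₀ τ₁ τ₂ ρ c₁ c₂ c : ℝ) (g : ℝ → ℝ) (v : ℝ → ℤ → ℂ)
    (hs : ∀ J ∈ W, |s J| ≤ 1) (hγ : γ ^ 2 = s 0 ^ 2 + s (-1) ^ 2) (hγ0 : 0 ≤ γ)
    (hΔ : ∀ J ∈ W, J ≠ 0 → d 0 + Δ ≤ d J) (hΔ0 : 0 < Δ) (hΛ : 0 < Λ)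
    (hτ₁ : 0 < τ₁) (hτ₂ : 0 < τ₂) (hρ : 0 < ρ) (hc₁ : |c₁| ≤ c) (hc₂ : |c₂| ≤ c)
    (hR : 0 < R) (htrap : c * γ * (1 + R ^ 2) < Δ * R)
    (hgdef : ∀ t ∈ Icc t₀ (t₀ + (τ₁ + τ₂)), g t =
      c₁ * LatticeWord.trapezoid 0 τ₁ ρ (t - t₀) + c₂ * LatticeWord.trapezoid τ₁ τ₂ ρ (t - t₀))
    (hsupp : ∀ t ∈ Icc t₀ (t₀ + (τ₁ + τ₂)), ∀ J, J ∉ W → v t J = 0)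
    (hderiv : ∀ t ∈ Icc t₀ (t₀ + (τ₁ + τ₂)), ∀ J ∈ W, HasDerivWithinAt (fun t' => v t' J)
        (-(Λ : ℂ) * ((d J : ℂ) * v t J) - (g t : ℂ) * (Λ : ℂ) * ((s (J - 1) : ℂ) * v t (J - 1) - (s J : ℂ) * v t (J + 1)))
        (Icc t₀ (t₀ + (τ₁ + τ₂))) t)
    (hcol : ∀ J, J ≠ 0 → v t₀ J = 0) (hv0 : v t₀ 0 ≠ 0) :
    Real.sqrt (∑ J ∈ W.erase 0, ‖v (t₀ + (τ₁ + τ₂)) J‖ ^ 2) ≤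
      (c * R * (2 + γ * R) / Δ +
        (|c₁| / (ρ * τ₁) + |c₂| / (ρ * τ₂)) / Λ * (|s 0| / (d 1 - d 0) ^ 2 + |s (-1)| / (d (-1) - d 0) ^ 2)) *
        ‖v (t₀ + (τ₁ + τ₂)) 0‖ := by
  classical
  have hδp0 : 0 < d 1 - d 0 := by have := hΔ 1 h1 one_ne_zero; linarith
  have hδm0 : 0 < d (-1) - d 0 := by have := hΔ (-1) hm1 (by norm_num); linarith
  have hlp0 : 0 < Λ * (d 1 - d 0) := mul_pos hΛ hδp0
  have hlm0 : 0 < Λ * (d (-1) - d 0) := mul_pos hΛ hδm0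
  have hc0 : 0 ≤ c := (abs_nonneg _).trans hc₁
  have ht₁mem : t₀ + (τ₁ + τ₂) ∈ Icc t₀ (t₀ + (τ₁ + τ₂)) := right_mem_Icc.2 (by linarith)
  set a : ℝ → ℝ := fun x => c₁ * LatticeWord.trapezoid 0 τ₁ ρ x + c₂ * LatticeWord.trapezoid τ₁ τ₂ ρ x with hadef
  have ha : Continuous a := continuous_pairEnvelope τ₁ τ₂ ρ c₁ c₂
  set J : ℝ → ℝ → ℝ := fun lam x => Real.exp (-lam * x) * ∫ y in (0:ℝ)..x, Real.exp (lam * y) * a y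
    with hJdef
  have hJ : ∀ lam x, HasDerivAt (J lam) (a x - lam * J lam x) x := fun lam x => by
    simp only [hJdef]; exact hasDerivAt_duhamel ha lam x
  have hJ0 : ∀ lam, J lam 0 = 0 := fun lam => by
    simp only [hJdef, intervalIntegral.integral_same, mul_zero]
  have hshift : ∀ t, HasDerivAt (fun t => t - t₀) 1 t := fun t => (hasDerivAt_id t).sub_const t₀
  have hga : ∀ t ∈ Icc t₀ (t₀ + (τ₁ + τ₂)), g t = a (t - t₀) := fun t ht => by rw [hgdef t ht]
  have hjd : ∀ lam, ∀ t ∈ Icc t₀ (t₀ + (τ₁ + τ₂)), HasDerivWithinAt (fun t => J lam (t - t₀))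
      (g t - lam * J lam (t - t₀)) (Icc t₀ (t₀ + (τ₁ + τ₂))) t := by
    intro lam t ht
    have h := (hJ lam (t - t₀)).comp t (hshift t)
    refine (h.congr_deriv ?_).hasDerivWithinAt
    rw [hga t ht]
    ring
  have hg : ∀ t ∈ Ioo t₀ (t₀ + (τ₁ + τ₂)), |g t| ≤ c := by
    intro t ht
    rw [hgdef t (Ioo_subset_Icc_self ht)]
    exact abs_pairEnvelope_le hτ₁ hτ₂ hρ hc₁ hc₂ (t - t₀)
  -- end values of the responses
  have hJend : ∀ lam, 0 < lam → |J lam (t₀ + (τ₁ + τ₂) - t₀)| ≤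
      |c₁| * (1 / (ρ * τ₁ * lam ^ 2)) + |c₂| * (1 / (ρ * τ₂ * lam ^ 2)) := by
    intro lam hlam
    rw [add_sub_cancel_left]
    simp only [hJdef, hadef]
    exact abs_duhamel_pair_end_le hτ₁ hτ₂ hρ hlam c₁ c₂
  -- the slaved profile with remainder `Q`
  have hrem := column_remainder_intWindow W h0 h1 hm1 d s Λ c Δ γ R t₀ (t₀ + (τ₁ + τ₂)) g
    (fun t => J (Λ * (d 1 - d 0)) (t - t₀)) (fun t => J (Λ * (d (-1) - d 0)) (t - t₀)) v
    hs hγ hγ0 hΔ hΔ0 hΛ hg hc0 hR htrap hsupp hderiv hcol hv0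
    (hjd (Λ * (d 1 - d 0))) (by simp only [sub_self, hJ0])
    (hjd (Λ * (d (-1) - d 0))) (by simp only [sub_self, hJ0]) (t₀ + (τ₁ + τ₂)) ht₁mem
  have hinit : ∑ J ∈ W.erase 0, ‖v t₀ J‖ ^ 2 < R ^ 2 * ‖v t₀ 0‖ ^ 2 := by
    rw [Finset.sum_eq_zero (fun J hJ => by rw [hcol J (Finset.ne_of_mem_erase hJ), norm_zero, zero_pow two_ne_zero])]
    exact mul_pos (pow_pos hR 2) (pow_pos (norm_pos_iff.2 hv0) 2)
  have hcone := cone_intWindow W h0 h1 hm1 d s Λ c Δ γ R t₀ (t₀ + (τ₁ + τ₂)) g v hγ hγ0 hΔ hΛ hg hR htrap hsupp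
    hderiv hinit (t₀ + (τ₁ + τ₂)) ht₁mem
  have hn0 : 0 < ‖v (t₀ + (τ₁ + τ₂)) 0‖ := hcone.2
  set Q : ℝ := c * R * (2 + γ * R) / Δ with hQdef
  have hQ0 : 0 ≤ Q := by rw [hQdef]; positivity
  set prof : ℤ → ℂ := fun I => if I = 1 then -(Λ : ℂ) * (s 0 : ℂ) * ((J (Λ * (d 1 - d 0)) (t₀ + (τ₁ + τ₂) - t₀) : ℝ) : ℂ)
    else if I = -1 then (Λ : ℂ) * (s (-1) : ℂ) * ((J (Λ * (d (-1) - d 0)) (t₀ + (τ₁ + τ₂) - t₀) : ℝ) : ℂ) else 0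
    with hprof
  have hrem' : ∑ J ∈ W.erase 0, ‖v (t₀ + (τ₁ + τ₂)) J / v (t₀ + (τ₁ + τ₂)) 0 - prof J‖ ^ 2 ≤ Q ^ 2 := by
    simpa only [hprof, hQdef] using hrem
  have hfac : Real.sqrt (∑ J ∈ W.erase 0, ‖v (t₀ + (τ₁ + τ₂)) J‖ ^ 2) =
      Real.sqrt (∑ J ∈ W.erase 0, ‖v (t₀ + (τ₁ + τ₂)) J / v (t₀ + (τ₁ + τ₂)) 0‖ ^ 2) *
        ‖v (t₀ + (τ₁ + τ₂)) 0‖ := by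
    have e : ∑ J ∈ W.erase 0, ‖v (t₀ + (τ₁ + τ₂)) J‖ ^ 2 =
        (∑ J ∈ W.erase 0, ‖v (t₀ + (τ₁ + τ₂)) J / v (t₀ + (τ₁ + τ₂)) 0‖ ^ 2) * ‖v (t₀ + (τ₁ + τ₂)) 0‖ ^ 2 := by
      rw [Finset.sum_mul]
      refine Finset.sum_congr rfl fun J _ => ?_
      rw [norm_div, div_pow, div_mul_cancel₀ _ (pow_ne_zero 2 hn0.ne')]
    rw [e, Real.sqrt_mul (Finset.sum_nonneg fun J _ => sq_nonneg _), Real.sqrt_sq hn0.le]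
  have hmink : Real.sqrt (∑ J ∈ W.erase 0, ‖v (t₀ + (τ₁ + τ₂)) J / v (t₀ + (τ₁ + τ₂)) 0‖ ^ 2) ≤
      Real.sqrt (∑ J ∈ W.erase 0, ‖v (t₀ + (τ₁ + τ₂)) J / v (t₀ + (τ₁ + τ₂)) 0 - prof J‖ ^ 2) +
        Real.sqrt (∑ J ∈ W.erase 0, ‖prof J‖ ^ 2) := by
    refine le_trans (Real.sqrt_le_sqrt (Finset.sum_le_sum fun J _ => ?_))
      (sqrt_sum_add_sq_le (W.erase 0) (fun J => ‖v (t₀ + (τ₁ + τ₂)) J / v (t₀ + (τ₁ + τ₂)) 0 - prof J‖)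
        (fun J => ‖prof J‖))
    have h := norm_add_le (v (t₀ + (τ₁ + τ₂)) J / v (t₀ + (τ₁ + τ₂)) 0 - prof J) (prof J)
    rw [sub_add_cancel] at h
    exact pow_le_pow_left₀ (norm_nonneg _) h 2
  have hprof_le : Real.sqrt (∑ J ∈ W.erase 0, ‖prof J‖ ^ 2) ≤
      (|c₁| / (ρ * τ₁) + |c₂| / (ρ * τ₂)) / Λ * (|s 0| / (d 1 - d 0) ^ 2 + |s (-1)| / (d (-1) - d 0) ^ 2) := by
    have hm1' : (-1 : ℤ) ∈ W.erase 0 := Finset.mem_erase.2 ⟨by norm_num, hm1⟩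
    have h1' : (1 : ℤ) ∈ (W.erase 0).erase (-1) :=
      Finset.mem_erase.2 ⟨by norm_num, Finset.mem_erase.2 ⟨by norm_num, h1⟩⟩
    have hsum : ∑ J ∈ W.erase 0, ‖prof J‖ ^ 2 = ‖prof (-1)‖ ^ 2 + ‖prof 1‖ ^ 2 := by
      rw [← Finset.add_sum_erase _ _ hm1', ← Finset.add_sum_erase _ _ h1']
      have hrest : ∑ J ∈ ((W.erase 0).erase (-1)).erase 1, ‖prof J‖ ^ 2 = 0 := by
        refine Finset.sum_eq_zero fun J hJ => ?_
        have hJ1 : J ≠ 1 := Finset.ne_of_mem_erase hJ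
        have hJ2 : J ≠ -1 := Finset.ne_of_mem_erase (Finset.mem_of_mem_erase hJ)
        simp [hprof, hJ1, hJ2]
      rw [hrest, add_zero]
    have hpm : ‖prof (-1)‖ = Λ * |s (-1)| * |J (Λ * (d (-1) - d 0)) (t₀ + (τ₁ + τ₂) - t₀)| := by
      simp only [hprof, show (-1 : ℤ) ≠ 1 by norm_num, if_false, if_true, norm_mul, Complex.norm_real,
        Real.norm_eq_abs, abs_of_pos hΛ]
    have hpp : ‖prof 1‖ = Λ * |s 0| * |J (Λ * (d 1 - d 0)) (t₀ + (τ₁ + τ₂) - t₀)| := by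
      simp only [hprof, if_true, norm_mul, norm_neg, Complex.norm_real, Real.norm_eq_abs, abs_of_pos hΛ]
    have hA : ‖prof (-1)‖ ≤ (|c₁| / (ρ * τ₁) + |c₂| / (ρ * τ₂)) / Λ * (|s (-1)| / (d (-1) - d 0) ^ 2) := by
      rw [hpm]
      calc Λ * |s (-1)| * |J (Λ * (d (-1) - d 0)) (t₀ + (τ₁ + τ₂) - t₀)|
          ≤ Λ * |s (-1)| * (|c₁| * (1 / (ρ * τ₁ * (Λ * (d (-1) - d 0)) ^ 2)) +
              |c₂| * (1 / (ρ * τ₂ * (Λ * (d (-1) - d 0)) ^ 2))) :=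
            mul_le_mul_of_nonneg_left (hJend _ hlm0) (by positivity)
        _ = (|c₁| / (ρ * τ₁) + |c₂| / (ρ * τ₂)) / Λ * (|s (-1)| / (d (-1) - d 0) ^ 2) := by
            field_simp
    have hB : ‖prof 1‖ ≤ (|c₁| / (ρ * τ₁) + |c₂| / (ρ * τ₂)) / Λ * (|s 0| / (d 1 - d 0) ^ 2) := by
      rw [hpp]
      calc Λ * |s 0| * |J (Λ * (d 1 - d 0)) (t₀ + (τ₁ + τ₂) - t₀)|
          ≤ Λ * |s 0| * (|c₁| * (1 / (ρ * τ₁ * (Λ * (d 1 - d 0)) ^ 2)) +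
              |c₂| * (1 / (ρ * τ₂ * (Λ * (d 1 - d 0)) ^ 2))) :=
            mul_le_mul_of_nonneg_left (hJend _ hlp0) (by positivity)
        _ = (|c₁| / (ρ * τ₁) + |c₂| / (ρ * τ₂)) / Λ * (|s 0| / (d 1 - d 0) ^ 2) := by
            field_simp
    rw [hsum]
    have hsq : ‖prof (-1)‖ ^ 2 + ‖prof 1‖ ^ 2 ≤ (‖prof (-1)‖ + ‖prof 1‖) ^ 2 := by
      nlinarith [norm_nonneg (prof (-1)), norm_nonneg (prof 1)]
    calc Real.sqrt (‖prof (-1)‖ ^ 2 + ‖prof 1‖ ^ 2) ≤ Real.sqrt ((‖prof (-1)‖ + ‖prof 1‖) ^ 2) :=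
          Real.sqrt_le_sqrt hsq
      _ = ‖prof (-1)‖ + ‖prof 1‖ := Real.sqrt_sq (by positivity)
      _ ≤ _ := by
          have := add_le_add hA hB
          linarith
  have hfirst : Real.sqrt (∑ J ∈ W.erase 0, ‖v (t₀ + (τ₁ + τ₂)) J / v (t₀ + (τ₁ + τ₂)) 0 - prof J‖ ^ 2) ≤ Q :=
    (Real.sqrt_le_sqrt hrem').trans (le_of_eq (Real.sqrt_sq hQ0))
  rw [hfac]
  exact mul_le_mul_of_nonneg_right ((hmink.trans (add_le_add hfirst hprof_le))) hn0.le

end IntWindowLadder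

end Literature.Analysis.ODE
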